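import Summits.CriticalPhenomena.PercolationContinuityZ3.Theorems.PercNearOneGluingNoHeavyLowerTailThreePointLBSwitchingMaps
import Mathlib.Tactic.FinCases
import HarnessLib

/-!
# `NoHeavyLowerTail` (stmt-CriticalPhenomena-4575) — `T_inc` (the increasing dual of 3PT-LB) by five switchings, I:
# the two REVEAL-ONLY switchings `Ψ₃ = (a reveal; c→Z)`, `Ψ₄ = (b reveal; c→Y)` preserve `μ ⊗ μ ⊗ μ`

Support file (prover prim-e3grp-switch-1; `--supports stmt-CriticalPhenomena-4575`).  No named facts, no sorries.

prim-e3grp-switch-1's five-program certificate "I5" for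
`T_inc = E₃({a↔b}∪{a↔c}, {a↔b}∪{b↔c}, {a↔c}∪{b↔c}) = (1+q)(qt − e₂(u)) − e₃(u) ≥ 0` (PROOF-TINC.md, 2026-08-20; found by
the extended switching LP, kit j081908) uses, besides the one- and two-cluster exchanges of file
`…ThreePointLBSwitchingMaps` (`phi2 v` = explore `K_v(X)` and exchange `X ↔ Z` on its pairs; `phi3 c a` = `(c→Y; a→Z)`),
two Gladkov–Zimin trees with a REVEAL-ONLY first step [GladkovZimin2024, proof of Thm. 4.6: regions put into `S̄`]:
* `psi3 a c (X,Y,Z) = (Z_{S} X, Y, X_{S} Z)`, `S = touch (cl X c) ∖ touch (cl X a)`: reveal the pairs meeting `K_a(X)`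
  (change nothing there), then explore `K_c(X)` through the remaining pairs and exchange `X ↔ Z` on them;
* `psi4 b c (X,Y,Z) = (Y_{S'} X, X_{S'} Y, Z)`, `S' = touch (cl X c) ∖ touch (cl X b)`.
No new switching lemma is needed: `psi3 a c = τ ∘ phi1 a ∘ τ ∘ phi3 a c` with `τ` the exchange of copies `0, 1`
(`phi3 a c` sends `touch A` to copy `1` and `S` to copy `2`; `phi1 a` read through `τ` finds the same region `touch A`
in copy `1` — a sealed cluster is determined by the pairs meeting it, `cl_splice_touch` — and undoes that exchange),
so measure preservation follows from `sum_wt3W_phi1`, `sum_wt3W_phi3` and `DTree3.sum_triples_comp_perm`;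
`psi4` is `psi3` conjugated by the exchange of copies `1, 2`.
-/

noncomputable section

namespace Summit.CriticalPhenomena.PercolationContinuityZ3.Theorems

namespace TIncSwitching

open Finset Literature.Probability.Percolation Literature.Probability.Percolation.DecisionTree
open Literature.Probability.Percolation.Gladkov ThreePointLB
open scoped Classical

variable {V : Type*} [Fintype V] [DecidableEq V]

/-! ### The reveal-only switchings -/

/-- `Ψ₃(X,Y,Z) = (Z on S | X, Y, X on S | Z)`, `S = touch (cl X c) ∖ touch (cl X a)`: reveal `K_a(X)`, then explore
`K_c(X)` through the remaining pairs and exchange copies `0, 2` there.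
[cite: GladkovZimin2024, Lemma 4.2 and proof of Thm. 4.6 (reveal-only region)] -/
def psi3 (a c : V) (x : Fin 3 → Finset (Sym2 V)) : Fin 3 → Finset (Sym2 V) := fun k =>
  if k = 0 then splice (touch (cl (x 0) c) \ touch (cl (x 0) a)) (x 2) (x 0)
  else if k = 1 then x 1
  else splice (touch (cl (x 0) c) \ touch (cl (x 0) a)) (x 0) (x 2)

/-- `Ψ₄(X,Y,Z) = (Y on S' | X, X on S' | Y, Z)`, `S' = touch (cl X c) ∖ touch (cl X b)`: `Ψ₃` with the roles of
copies `1, 2` exchanged. [cite: GladkovZimin2024, Lemma 4.2 and proof of Thm. 4.6 (reveal-only region)] -/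
def psi4 (b c : V) (x : Fin 3 → Finset (Sym2 V)) : Fin 3 → Finset (Sym2 V) := fun k =>
  psi3 b c (fun i => x (Equiv.swap 1 2 i)) (Equiv.swap 1 2 k)

section Outputs

variable (a b c : V) (x : Fin 3 → Finset (Sym2 V))

/-- Output `0` of `Ψ₃`. [this work] -/
@[simp] theorem psi3_zero : psi3 a c x 0 = splice (touch (cl (x 0) c) \ touch (cl (x 0) a)) (x 2) (x 0) := by simp [psi3]
/-- Output `1` of `Ψ₃`. [this work] -/
@[simp] theorem psi3_one : psi3 a c x 1 = x 1 := by simp [psi3]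
/-- Output `2` of `Ψ₃`. [this work] -/
@[simp] theorem psi3_two : psi3 a c x 2 = splice (touch (cl (x 0) c) \ touch (cl (x 0) a)) (x 0) (x 2) := by
  simp [psi3, show (2 : Fin 3) ≠ 0 from by decide, show (2 : Fin 3) ≠ 1 from by decide]

/-- `(1 2)` fixes `0` in `Fin 3`. [folklore] -/
private theorem swap12_0 : (Equiv.swap (1 : Fin 3) 2) 0 = 0 := by decide
/-- `(1 2)` sends `1 ↦ 2` in `Fin 3`. [folklore] -/
private theorem swap12_1 : (Equiv.swap (1 : Fin 3) 2) 1 = 2 := by decide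
/-- `(1 2)` sends `2 ↦ 1` in `Fin 3`. [folklore] -/
private theorem swap12_2 : (Equiv.swap (1 : Fin 3) 2) 2 = 1 := by decide

/-- Output `0` of `Ψ₄`. [this work] -/
@[simp] theorem psi4_zero : psi4 b c x 0 = splice (touch (cl (x 0) c) \ touch (cl (x 0) b)) (x 1) (x 0) := by
  simp only [psi4, swap12_0, psi3_zero, swap12_2]
/-- Output `1` of `Ψ₄`. [this work] -/
@[simp] theorem psi4_one : psi4 b c x 1 = splice (touch (cl (x 0) c) \ touch (cl (x 0) b)) (x 0) (x 1) := by
  simp only [psi4, swap12_1, psi3_two, swap12_0, swap12_2]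
/-- Output `2` of `Ψ₄`. [this work] -/
@[simp] theorem psi4_two : psi4 b c x 2 = x 2 := by
  simp only [psi4, swap12_2, psi3_one, swap12_1]

end Outputs

/-! ### `Ψ₃` as a composite of measure-preserving maps -/

/-- `(0 1)` sends `0 ↦ 1` in `Fin 3`. [folklore] -/
private theorem swap01_0 : (Equiv.swap (0 : Fin 3) 1) 0 = 1 := by decide
/-- `(0 1)` sends `1 ↦ 0` in `Fin 3`. [folklore] -/
private theorem swap01_1 : (Equiv.swap (0 : Fin 3) 1) 1 = 0 := by decide
/-- `(0 1)` fixes `2` in `Fin 3`. [folklore] -/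
private theorem swap01_2 : (Equiv.swap (0 : Fin 3) 1) 2 = 2 := by decide

/-- **`Ψ₃ = τ ∘ Φ₁(a) ∘ τ ∘ Φ₃(a,c)`**, `τ` = exchange of copies `0, 1`: the two-region exchange `Φ₃(a,c)` followed by
the undoing of its first exchange (the region `touch (cl X a)` is read back from copy `1`, where the sealed cluster of
`a` is still `cl X a`, `cl_splice_touch`). [this work] -/
theorem psi3_eq_comp (a c : V) (x : Fin 3 → Finset (Sym2 V)) :
    psi3 a c x = fun k => phi1 a (fun i => phi3 a c x (Equiv.swap 0 1 i)) (Equiv.swap 0 1 k) := by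
  -- the region found by `phi1 a` in copy `1` of `Φ₃(a,c) x` is again `touch (cl (x 0) a)`
  have hreg : touch (cl (phi3 a c x 1) a) = touch (cl (x 0) a) := by
    rw [phi3_one, cl_splice_touch]
  funext k
  fin_cases k
  · -- output 0
    rw [show ((⟨0, by norm_num⟩ : Fin 3)) = 0 from rfl, psi3_zero, swap01_0, phi1_one, swap01_0, swap01_1,
      hreg, phi3_one, phi3_zero]
    ext i
    by_cases hiA : i ∈ touch (cl (x 0) a)
    · have hiS : i ∉ touch (cl (x 0) c) \ touch (cl (x 0) a) := fun h => (Finset.mem_sdiff.1 h).2 hiA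
      simp [mem_splice, hiA, hiS]
    · by_cases hiS : i ∈ touch (cl (x 0) c) \ touch (cl (x 0) a)
      · simp [mem_splice, hiA, hiS]
      · simp [mem_splice, hiA, hiS]
  · -- output 1
    rw [show ((⟨1, by norm_num⟩ : Fin 3)) = 1 from rfl, psi3_one, swap01_1, phi1_zero, swap01_0, swap01_1,
      hreg, phi3_one, phi3_zero]
    ext i
    by_cases hiA : i ∈ touch (cl (x 0) a)
    · simp [mem_splice, hiA]
    · simp [mem_splice, hiA]
  · -- output 2
    rw [show ((⟨2, by norm_num⟩ : Fin 3)) = 2 from rfl, psi3_two, swap01_2, phi1_two, swap01_2, phi3_two]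

/-! ### Each switching preserves the triple law -/

section Law

variable (p : Sym2 V → ℝ) (D : Finset (Sym2 V)) (a b c : V) (f : (Fin 3 → Finset (Sym2 V)) → ℝ)

/-- **`Ψ₃` preserves `μ ⊗ μ ⊗ μ`** (composite of `Φ₃(a,c)`, `Φ₁(a)` and two exchanges of copies `0, 1`).
[cite: GladkovZimin2024, Lemma 4.2] -/
theorem sum_wt3W_psi3 :
    ∑ x ∈ triples D, wt3W D p x * f (psi3 a c x) = ∑ x ∈ triples D, wt3W D p x * f x := by
  set τ : Equiv.Perm (Fin 3) := Equiv.swap 0 1 with hτ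
  have hpsi : ∀ x, psi3 a c x = fun k => phi1 a (fun i => phi3 a c x (τ i)) (τ k) := psi3_eq_comp a c
  calc ∑ x ∈ triples D, wt3W D p x * f (psi3 a c x)
      = ∑ x ∈ triples D, wt3W D p x * (fun y => f (fun k => phi1 a (fun i => y (τ i)) (τ k))) (phi3 a c x) := by
        refine Finset.sum_congr rfl fun x _ => ?_
        rw [hpsi]
    _ = ∑ y ∈ triples D, wt3W D p y * f (fun k => phi1 a (fun i => y (τ i)) (τ k)) :=
        sum_wt3W_phi3 p D a c (fun y => f (fun k => phi1 a (fun i => y (τ i)) (τ k)))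
    _ = ∑ y ∈ triples D, (fun z => wt3W D p z * f (fun k => phi1 a z (τ k))) (fun i => y (τ i)) := by
        refine Finset.sum_congr rfl fun y _ => ?_
        simp only [DTree3.wt3W_comp_perm]
    _ = ∑ z ∈ triples D, wt3W D p z * f (fun k => phi1 a z (τ k)) :=
        DTree3.sum_triples_comp_perm D τ (fun z => wt3W D p z * f (fun k => phi1 a z (τ k)))
    _ = ∑ z ∈ triples D, wt3W D p z * f (fun k => z (τ k)) :=
        sum_wt3W_phi1 p D a (fun z => f (fun k => z (τ k)))
    _ = ∑ z ∈ triples D, wt3W D p z * f z := by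
        have h := DTree3.sum_triples_comp_perm D τ (fun y => wt3W D p y * f y)
        simpa only [DTree3.wt3W_comp_perm] using h

/-- **`Ψ₄` preserves `μ ⊗ μ ⊗ μ`** (`Ψ₃(b,c)` conjugated by the exchange of copies `1, 2`).
[cite: GladkovZimin2024, Lemma 4.2] -/
theorem sum_wt3W_psi4 :
    ∑ x ∈ triples D, wt3W D p x * f (psi4 b c x) = ∑ x ∈ triples D, wt3W D p x * f x := by
  set σ : Equiv.Perm (Fin 3) := Equiv.swap 1 2 with hσ
  have hpsi : ∀ x, psi4 b c x = fun k => psi3 b c (fun i => x (σ i)) (σ k) := fun x => rfl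
  calc ∑ x ∈ triples D, wt3W D p x * f (psi4 b c x)
      = ∑ x ∈ triples D, (fun y => wt3W D p y * f (fun k => psi3 b c y (σ k))) (fun i => x (σ i)) := by
        refine Finset.sum_congr rfl fun x _ => ?_
        simp only [hpsi, DTree3.wt3W_comp_perm]
    _ = ∑ y ∈ triples D, wt3W D p y * f (fun k => psi3 b c y (σ k)) :=
        DTree3.sum_triples_comp_perm D σ (fun y => wt3W D p y * f (fun k => psi3 b c y (σ k)))
    _ = ∑ y ∈ triples D, wt3W D p y * f (fun k => y (σ k)) :=
        sum_wt3W_psi3 p D b c (fun y => f (fun k => y (σ k)))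
    _ = ∑ y ∈ triples D, wt3W D p y * f y := by
        have h := DTree3.sum_triples_comp_perm D σ (fun y => wt3W D p y * f y)
        simpa only [DTree3.wt3W_comp_perm] using h

end Law

end TIncSwitching

end Summit.CriticalPhenomena.PercolationContinuityZ3.Theorems

end
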